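import Summits.AnomalousDissipation.AnomalousDissipation.Theorems.SolenoidalFractalHomogenisationLagrangianStepCellChainEnergy
import Summits.AnomalousDissipation.AnomalousDissipation.Theorems.SolenoidalFractalHomogenisationLagrangianStepCellChainClassPair
import Summits.AnomalousDissipation.AnomalousDissipation.Theorems.SolenoidalFractalHomogenisationLagrangianStepCellChainModes
import HarnessLib

/-!
# K1L_D `LagrangianRenormalisationStepDesign` (stmt-AnomalousDissipation-27980), W7 engine sub-piece S1a: the SET-UP of the mode calculus from the
# binders of `ClassDecayW` — one call turns `(ν, n, 𝔸 in the ν-scaled nested window, class-pair datum F, weak cell solution u)` into the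
# window of the weak-form tensor, the datum facts, the energy package, the class-pair confinement and the continuous representatives
# (helper; `--supports stmt-AnomalousDissipation-27980`)

Summits-side helper file of route `SolenoidalFractalHomogenisation` (prover seat `ad-k1l-cellLawV-w1` g4; plumbing for the W7 assembly owner's (R-a)/(R-d),
STATUS 22:16:05Z).  Everything proved; no definitions, no named facts, no sorry.  `classDecayW_setup` takes EXACTLY the binder prefix of
`ClassDecayW W M hM lo hi Λ β ν₀ Kb CK cK adm` (DefsW7 p665306) down to the weak solution `u` — `ν > 0`, `n ≥ 1`, `𝔸` with
`∃ lam ∈ [1,Λ], NearIso 𝔸 (ν·lo/lam) (ν·hi·lam)`, `ℓ`, `F` with `IsDatum F` and no modes off `(ℓ + nℤ³) ∪ (−ℓ + nℤ³)`, `T > 0`,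
`u` with `IsWeakTensorPassiveVectorOn 0 T ((1/n²)•𝔸) (cellField W M hM ν _ n) F u` — and returns: (a) `NearIso ((1/n²)•𝔸) lo' hi'` with the LAM-FREE constants
`lo' = (1/n²)·(ν·(lo/Λ))`, `hi' = (1/n²)·(ν·(hi·Λ))` (`NearIso.mono` + `NearIso.smul`); (b) `MemLp F 2`, `Integrable F`, `IsWeaklyDivFree F`; (c) the energy
package of `exists_energyRep` at `(𝔹, lo') = ((1/n²)•𝔸, lo')` (11 conjuncts, see `…CellChainEnergy`); (d) the class-pair confinement
`ae_modes_vanish_off_classPair`; (e) `ae_forall_eq_modeRep` for the stretched word `W₁ = (W.stretch M).stretch (1/ν)` (`cellField_eq_cell`).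
NOT a proof of any registered stub, of the crux, or of anomalous dissipation; rung F-D1.A0 infrastructure.
-/

set_option linter.dupNamespace false

noncomputable section

namespace Summit.AnomalousDissipation.AnomalousDissipation.Theorems.SolenoidalFractalHomogenisation.LagrangianStep.CellChain

open Set MeasureTheory Filter Topology Function Complex UnitAddTorus
open scoped InnerProductSpace ComplexConjugate ENNReal
open Literature.Analysis Literature.Analysis.FunctionSpaces Literature.Analysis.FunctionSpaces.Torus
open Literature.Analysis.FluidPDE Literature.Analysis.FluidPDE.Torus Literature.Analysis.FluidPDE.LatticeShear
open Summit.AnomalousDissipation.AnomalousDissipation.Theorems.SolenoidalFractalHomogenisation.RealisedQuasiStaticCellLaw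
open Summit.AnomalousDissipation.AnomalousDissipation.Theorems.SolenoidalFractalHomogenisation.LagrangianStep

/-- The nested window of `ClassDecayW` gives a LAM-FREE Legendre–Hadamard window for the weak-form tensor `(1/n²)•𝔸`:
`NearIso ((1/n²)•𝔸) ((1/n²)·(ν·(lo/Λ))) ((1/n²)·(ν·(hi·Λ)))` (`1 ≤ lam ≤ Λ`, `0 ≤ lo`, `0 ≤ hi`, `0 ≤ ν`).
[cite: Giaquinta1983MultipleIntegrals, Ch. III §2 eq. (2.1)-(2.2)] -/
theorem nearIso_weakTensor_of_window {𝔸 : Torus.Visc4 (Fin 3)} {lo hi Λ ν : ℝ} (hlo : 0 ≤ lo) (hhi : 0 ≤ hi) (hν : 0 ≤ ν) (n : ℕ)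
    (hwin : ∃ lam ∈ Set.Icc (1:ℝ) Λ, Torus.NearIso 𝔸 (ν * (lo / lam)) (ν * (hi * lam))) :
    Torus.NearIso ((1 / (n:ℝ) ^ 2) • 𝔸) ((1 / (n:ℝ) ^ 2) * (ν * (lo / Λ))) ((1 / (n:ℝ) ^ 2) * (ν * (hi * Λ))) := by
  obtain ⟨lam, hlam, hA⟩ := hwin
  have hlam1 : 0 < lam := lt_of_lt_of_le one_pos hlam.1
  have h1 : ν * (lo / Λ) ≤ ν * (lo / lam) :=
    mul_le_mul_of_nonneg_left (div_le_div_of_nonneg_left hlo hlam1 hlam.2) hν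
  have h2 : ν * (hi * lam) ≤ ν * (hi * Λ) := mul_le_mul_of_nonneg_left (mul_le_mul_of_nonneg_left hlam.2 hhi) hν
  exact (hA.mono h1 h2).smul (by positivity)

/-- **SET-UP OF THE MODE CALCULUS FROM THE BINDERS OF `ClassDecayW`.**  See the module docstring for the five outputs (a)–(e).
[cite: Temam1984, Ch. III §1 Lemma 1.2 (energy inequality)] [cite: KhaKuchment2021, §1.1–§1.2 (G-periodic operators, γ_k-automorphic functions)] -/
theorem classDecayW_setup {k : ℕ} (W : LatticeWord k) (M : ℝ) (hM : 0 < M) {lo hi Λ ν : ℝ} (hlo : 0 < lo) (hhi : 0 ≤ hi) (hΛ : 1 ≤ Λ)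
    (hν : 0 < ν) {n : ℕ} (hn : 1 ≤ n) {𝔸 : Torus.Visc4 (Fin 3)}
    (hwin : ∃ lam ∈ Set.Icc (1:ℝ) Λ, Torus.NearIso 𝔸 (ν * (lo / lam)) (ν * (hi * lam)))
    (ℓ : Fin 3 → ℤ) {F : VF} (hF : IsDatum F)
    (hsupp : ∀ k' : Fin 3 → ℤ, (¬ ∃ z : Fin 3 → ℤ, k' = ℓ + (n : ℤ) • z) → (¬ ∃ z : Fin 3 → ℤ, k' = -ℓ + (n : ℤ) • z) →
      ∀ i, modeCoeff k' F i = 0)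
    {T : ℝ} (hT : 0 < T) {u : ℝ → VF}
    (hu : Torus.IsWeakTensorPassiveVectorOn 0 T ((1 / (n:ℝ) ^ 2) • 𝔸) (cellField W M hM ν hν n) F u) :
    Torus.NearIso ((1 / (n:ℝ) ^ 2) • 𝔸) ((1 / (n:ℝ) ^ 2) * (ν * (lo / Λ))) ((1 / (n:ℝ) ^ 2) * (ν * (hi * Λ))) ∧
    (MemLp F 2 volume ∧ Integrable F volume ∧ FunctionSpaces.Torus.IsWeaklyDivFree F) ∧
    (∃ E Q : ℝ → ℝ,
      E 0 = ∫ x, ‖F x‖ ^ 2 ∧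
      (∀ t ∈ Icc 0 T, E t = (∫ x, ‖F x‖ ^ 2) - 2 * ∫ s in (0:ℝ)..t, Q s) ∧
      ContinuousOn E (Icc 0 T) ∧
      AntitoneOn E (Icc 0 T) ∧
      (∀ a ∈ Icc 0 T, ∀ b' ∈ Icc 0 T, AbsolutelyContinuousOnInterval E a b') ∧
      (∀ᵐ t ∂(volume.restrict (Ioo 0 T)), E t = ∫ x, ‖u t x‖ ^ 2) ∧
      IntegrableOn Q (Ioo 0 T) ∧
      (∀ᵐ t ∂(volume.restrict (Ioo 0 T)), 0 ≤ Q t) ∧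
      (∀ᵐ t ∂(volume : Measure ℝ), t ∈ Ioo 0 T → HasDerivAt E (-(2 * Q t)) t) ∧
      (∀ᵐ t ∂(volume.restrict (Ioo 0 T)), ∀ S : Finset (Fin 3 → ℤ),
        4 * Real.pi ^ 2 * ∑ k' ∈ S, (⟪mFourierCoeff (EuclideanSpace.complexify ∘ u t) k',
          Torus.symbT ((1 / (n:ℝ) ^ 2) • 𝔸) k' (mFourierCoeff (EuclideanSpace.complexify ∘ u t) k')⟫_ℂ).re ≤ Q t) ∧
      (∀ᵐ t ∂(volume.restrict (Ioo 0 T)), ∀ k' : Fin 3 → ℤ,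
        0 ≤ (⟪mFourierCoeff (EuclideanSpace.complexify ∘ u t) k',
          Torus.symbT ((1 / (n:ℝ) ^ 2) • 𝔸) k' (mFourierCoeff (EuclideanSpace.complexify ∘ u t) k')⟫_ℂ).re ∧
        (1 / (n:ℝ) ^ 2) * (ν * (lo / Λ)) * (freqNormSq k' * ‖mFourierCoeff (EuclideanSpace.complexify ∘ u t) k'‖ ^ 2) ≤
          (⟪mFourierCoeff (EuclideanSpace.complexify ∘ u t) k',
            Torus.symbT ((1 / (n:ℝ) ^ 2) • 𝔸) k' (mFourierCoeff (EuclideanSpace.complexify ∘ u t) k')⟫_ℂ).re)) ∧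
    (∀ᵐ t ∂(volume.restrict (Ioo 0 T)), ∀ k' : Fin 3 → ℤ,
      (¬ ∃ z : Fin 3 → ℤ, k' = ℓ + (n : ℤ) • z) → (¬ ∃ z : Fin 3 → ℤ, k' = -ℓ + (n : ℤ) • z) →
      mFourierCoeff (FunctionSpaces.EuclideanSpace.complexify ∘ u t) k' = 0) ∧
    (∀ᵐ t ∂(volume.restrict (Ioo 0 T)), ∀ k' : Fin 3 → ℤ,
      mFourierCoeff (EuclideanSpace.complexify ∘ u t) k' =
        modeRep ((W.stretch M hM).stretch (1 / ν) (one_div_pos.mpr hν)) n ((1 / (n:ℝ) ^ 2) • 𝔸) F u k' t) := by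
  have hn0 : 0 < n := hn
  have hN := nearIso_weakTensor_of_window hlo.le hhi hν.le n hwin
  have hlo' : 0 < (1 / (n:ℝ) ^ 2) * (ν * (lo / Λ)) := by
    have : (0:ℝ) < n := by exact_mod_cast hn0
    have hΛ0 : 0 < Λ := lt_of_lt_of_le one_pos hΛ
    positivity
  have hF2 : MemLp F 2 volume := memLp_two_of_memSobolev_one_complexify hF.1
  have hFi : Integrable F volume := hF2.integrable one_le_two
  have hFdiv : FunctionSpaces.Torus.IsWeaklyDivFree F := hF.2.2
  refine ⟨hN, ⟨hF2, hFi, hFdiv⟩, ?_, ?_, ?_⟩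
  · -- the energy package for the cell carrier = the stretched word's cell
    have hu' : Torus.IsWeakTensorPassiveVectorOn 0 T ((1 / (n:ℝ) ^ 2) • 𝔸)
        (((W.stretch M hM).stretch (1 / ν) (one_div_pos.mpr hν)).cell n) F u := by rw [← cellField_eq_cell]; exact hu
    exact exists_energyRep_cell _ n hT hN hlo' hF2 hFdiv hu'
  · -- class-pair confinement (any `lam` in the window works; use the lam-free one with `lam := 1` bookkeeping absorbed in `hN`)
    have hsupp' : ∀ k' : Fin 3 → ℤ, (¬ ∃ z : Fin 3 → ℤ, k' = ℓ + (n : ℤ) • z) → (¬ ∃ z : Fin 3 → ℤ, k' = -ℓ + (n : ℤ) • z) →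
        mFourierCoeff (FunctionSpaces.EuclideanSpace.complexify ∘ F) k' = 0 := by
      intro k' h1 h2
      ext i
      rw [← modeCoeff_eq hFi, hsupp k' h1 h2 i]
      rfl
    -- `ae_modes_vanish_off_classPair` wants the window in the form `ν * (lo₁/lam₁)`, `ν * (hi₁*lam₁)`: take `lam₁ = 1`, `lo₁ = lo/Λ`, `hi₁ = hi*Λ`
    have hA1 : Torus.NearIso 𝔸 (ν * ((lo / Λ) / 1)) (ν * ((hi * Λ) * 1)) := by
      obtain ⟨lam, hlam, hA⟩ := hwin
      have hlam1 : 0 < lam := lt_of_lt_of_le one_pos hlam.1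
      rw [div_one, mul_one]
      exact hA.mono (mul_le_mul_of_nonneg_left (div_le_div_of_nonneg_left hlo.le hlam1 hlam.2) hν.le)
        (mul_le_mul_of_nonneg_left (mul_le_mul_of_nonneg_left hlam.2 hhi) hν.le)
    exact ae_modes_vanish_off_classPair W M hM (lo := lo / Λ) (hi := hi * Λ) (lam := 1)
      (div_pos hlo (lt_of_lt_of_le one_pos hΛ)) one_pos hν hn0 hA1 ℓ hF2 hsupp' hu
  · have hu' : Torus.IsWeakTensorPassiveVectorOn 0 T ((1 / (n:ℝ) ^ 2) • 𝔸)
        (((W.stretch M hM).stretch (1 / ν) (one_div_pos.mpr hν)).cell n) F u := by rw [← cellField_eq_cell]; exact hu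
    exact ae_forall_eq_modeRep _ n hT.le hu' hFi

end Summit.AnomalousDissipation.AnomalousDissipation.Theorems.SolenoidalFractalHomogenisation.LagrangianStep.CellChain

end
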